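import Literature.Probability.LatticeModels.BackboneKernel
import Literature.Probability.LatticeModels.ModifiedSimonInequality
import Literature.Probability.LatticeModels.LoopO1
import HarnessLib

/-!
# Vertex-set supermodularity of the sourceless high-temperature sum `Λ ↦ log g_Λ(∅)`

Helper file for item `DepletionBound` (stmt-CriticalPhenomena-14628) of route `FKParityRobustness`.

For a finite graph `G`, `β ≥ 0`, `t = tanh β` and two vertex sets `Λ₁, Λ₂`,

  `g_{Λ₁}(∅) · g_{Λ₂}(∅) ≤ g_{Λ₁ ∩ Λ₂}(∅) · g_{Λ₁ ∪ Λ₂}(∅)`,   `g_Λ = hteSum G Λ t`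

(`hteSum_empty_supermodular`).  This is the tree's edge-set supermodularity
`ghteSum_empty_supermodular` (Aizenman–Fernández 1986, Claim (4.15); Aizenman 1982, Lemma 9.3 —
PROVED in `BackboneKernel`) for the edge sets `X = ℰ_{Λ₁ ∪ Λ₂}`, `X ∖ A = ℰ_{Λ₁}`, `X ∖ B = ℰ_{Λ₂}`,
`X ∖ (A ∪ B) = ℰ_{Λ₁} ∩ ℰ_{Λ₂} = ℰ_{Λ₁ ∩ Λ₂}`, transported from the ghost graph on `Option V`
(where that theorem lives, with the constant coupling `θ ≡ β`, so that no ghost edge is ever used)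
back to `G` along the edge lift `liftEdge` (`ghteSum_map_liftEdge_empty`).

Also: `loopO1PartitionFunction_eq_hteSum` — the sourced loop-O(1) partition function of `LoopO1`
is the high-temperature sum `hteSum G univ t A` of `ModifiedSimonInequality`.
-/

noncomputable section

namespace Summit.CriticalPhenomena.Ising3DConformalLimit.Theorems.DepletionBound

open Finset
open Literature.Probability.LatticeModels

variable {V : Type*} [Fintype V] [DecidableEq V] (G : SimpleGraph V) [DecidableRel G.Adj]

/-! ### Degrees under the edge lift `V → Option V` -/

omit [Fintype V] [DecidableEq V] in
/-- A real vertex `u` lies on the lifted edge `liftEdge e` iff it lies on `e`. -/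
theorem some_mem_liftEdge_iff (u : V) (e : Sym2 V) : (some u : Option V) ∈ liftEdge e ↔ u ∈ e := by
  change (some u : Option V) ∈ Sym2.map some e ↔ u ∈ e
  rw [Sym2.mem_map]
  constructor
  · rintro ⟨a, ha, hau⟩
    rwa [← Option.some_injective _ hau]
  · intro hu
    exact ⟨u, hu, rfl⟩

omit [Fintype V] in
/-- The lifted edge set has the same degree at `some u` as the original one at `u`. -/
theorem card_filter_map_liftEdge_some (F : Finset (Sym2 V)) (u : V) :
    #((F.map liftEdge).filter fun e => (some u : Option V) ∈ e) = #(F.filter fun e => u ∈ e) := by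
  rw [Finset.filter_map, Finset.card_map]
  congr 1
  refine Finset.filter_congr fun e _ => ?_
  exact some_mem_liftEdge_iff u e

omit [Fintype V] in
/-- The ghost has degree `0` in a lifted edge set. -/
theorem card_filter_map_liftEdge_none (F : Finset (Sym2 V)) :
    #((F.map liftEdge).filter fun e => (none : Option V) ∈ e) = 0 := by
  rw [Finset.card_eq_zero, Finset.filter_eq_empty_iff]
  intro e he
  obtain ⟨e', -, rfl⟩ := Finset.mem_map.1 he
  exact none_not_mem_liftEdge e'

omit [DecidableRel G.Adj] in
/-- For an edge set inside `Λ'`, "no odd vertex in `Λ'`" and "the lift has no odd vertex in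
`univ ∪ {g}`" are the same condition (vertices off `Λ'`, and the ghost, have degree `0`). -/
theorem oddVerts_map_liftEdge_eq_empty_iff [G.LocallyFinite] {Λ' : Finset V} {F : Finset (Sym2 V)}
    (hF : F ⊆ edgesIn G Λ') :
    oddVerts (Finset.insertNone (Finset.univ : Finset V)) (F.map liftEdge) = ∅ ↔ oddVerts Λ' F = ∅ := by
  simp only [oddVerts, Finset.filter_eq_empty_iff]
  constructor
  · intro h v _ hodd
    refine h (x := some v) (Finset.mem_insertNone.2 (by simp)) ?_
    rwa [card_filter_map_liftEdge_some]
  · intro h v _ hodd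
    rcases v with _ | u
    · rw [card_filter_map_liftEdge_none] at hodd
      exact Nat.not_odd_zero hodd
    · rw [card_filter_map_liftEdge_some] at hodd
      by_cases hu : u ∈ Λ'
      · exact h hu hodd
      · -- `u ∉ Λ'` has degree `0`
        have h0 : #(F.filter fun e => u ∈ e) = 0 := by
          rw [Finset.card_eq_zero, Finset.filter_eq_empty_iff]
          intro e he hue
          exact hu ((mem_edgesIn_iff.1 (hF he)).2 u hue)
        rw [h0] at hodd
        exact Nat.not_odd_zero hodd

/-! ### Transport of `g_{E'}(∅)` along the lift -/

omit [DecidableRel G.Adj] in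
/-- **Transport.** The ghost-graph high-temperature sum of the lifted edges of `G` inside `Λ'`,
with constant coupling `β` and no sources, is `g_{Λ'}(∅)` at `t = tanh β`. -/
theorem ghteSum_map_liftEdge_empty [G.LocallyFinite] (β : ℝ) (Λ' : Finset V) :
    ghteSum (Finset.insertNone (Finset.univ : Finset V)) (fun _ : Sym2 (Option V) => β)
        ((edgesIn G Λ').map liftEdge) ∅ = hteSum G Λ' (Real.tanh β) ∅ := by
  unfold ghteSum hteSum
  simp only [Finset.prod_const]
  symm
  refine Finset.sum_bij (fun F _ => F.map liftEdge) ?_ ?_ ?_ ?_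
  · intro F hF
    rw [Finset.mem_filter, Finset.mem_powerset] at hF ⊢
    exact ⟨Finset.map_subset_map.2 hF.1, (oddVerts_map_liftEdge_eq_empty_iff G hF.1).2 hF.2⟩
  · intro F₁ _ F₂ _ h
    exact Finset.map_injective liftEdge h
  · intro F' hF'
    rw [Finset.mem_filter, Finset.mem_powerset] at hF'
    obtain ⟨F, hFE, rfl⟩ := Finset.subset_map_iff.1 hF'.1
    refine ⟨F, ?_, rfl⟩
    rw [Finset.mem_filter, Finset.mem_powerset]
    exact ⟨hFE, (oddVerts_map_liftEdge_eq_empty_iff G hFE).1 hF'.2⟩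
  · intro F _
    rw [Finset.card_map]

/-! ### Edge sets inside vertex sets -/

omit [Fintype V] [DecidableRel G.Adj] in
/-- `ℰ_{Λ₁} ∩ ℰ_{Λ₂} = ℰ_{Λ₁ ∩ Λ₂}`. -/
theorem edgesIn_inter [G.LocallyFinite] (Λ₁ Λ₂ : Finset V) :
    edgesIn G Λ₁ ∩ edgesIn G Λ₂ = edgesIn G (Λ₁ ∩ Λ₂) := by
  ext e
  simp only [Finset.mem_inter, mem_edgesIn_iff]
  constructor
  · rintro ⟨⟨he, h1⟩, -, h2⟩
    exact ⟨he, fun x hx => ⟨h1 x hx, h2 x hx⟩⟩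
  · rintro ⟨he, h⟩
    exact ⟨⟨he, fun x hx => (h x hx).1⟩, ⟨he, fun x hx => (h x hx).2⟩⟩

/-! ### Supermodularity in the vertex set -/

/-- **Vertex-set supermodularity of `Λ ↦ log g_Λ(∅)`** (Aizenman–Fernández 1986, Claim (4.15) /
Aizenman 1982, Lemma 9.3, in the tree as `ghteSum_empty_supermodular`): for `β ≥ 0`, `t = tanh β`,
`g_{Λ₁}(∅) g_{Λ₂}(∅) ≤ g_{Λ₁ ∩ Λ₂}(∅) g_{Λ₁ ∪ Λ₂}(∅)`. -/
theorem hteSum_empty_supermodular {β : ℝ} (hβ : 0 ≤ β) (Λ₁ Λ₂ : Finset V) :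
    hteSum G Λ₁ (Real.tanh β) ∅ * hteSum G Λ₂ (Real.tanh β) ∅ ≤
      hteSum G (Λ₁ ∩ Λ₂) (Real.tanh β) ∅ * hteSum G (Λ₁ ∪ Λ₂) (Real.tanh β) ∅ := by
  set X : Finset (Sym2 (Option V)) := (edgesIn G (Λ₁ ∪ Λ₂)).map liftEdge with hXdef
  set X₁ : Finset (Sym2 (Option V)) := (edgesIn G Λ₁).map liftEdge with hX₁def
  set X₂ : Finset (Sym2 (Option V)) := (edgesIn G Λ₂).map liftEdge with hX₂def
  have hX : X ⊆ edgesIn (ghostGraph G (Finset.univ : Finset V)) (Finset.insertNone Finset.univ) :=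
    (map_liftEdge_subset_edgesIn (G := G) (Λ := (Finset.univ : Finset V)) (Finset.subset_univ _)).trans
      (edgesIn_insertNone_mono (Finset.subset_univ _))
  have h1 : X₁ ⊆ X := Finset.map_subset_map.2 (edgesIn_mono G Finset.subset_union_left)
  have h2 : X₂ ⊆ X := Finset.map_subset_map.2 (edgesIn_mono G Finset.subset_union_right)
  have key := ghteSum_empty_supermodular (θ := fun _ : Sym2 (Option V) => β) (fun _ => hβ) hX
    (X \ X₁) (X \ X₂)
  rw [Finset.sdiff_sdiff_eq_self h1, Finset.sdiff_sdiff_eq_self h2,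
    show X \ (X \ X₁ ∪ X \ X₂) = X₁ ∩ X₂ by
      rw [← Finset.sdiff_inter_distrib_right, Finset.sdiff_sdiff_eq_self
        (Finset.inter_subset_left.trans h1)],
    hX₁def, hX₂def, ← Finset.map_inter, edgesIn_inter, hXdef,
    ghteSum_map_liftEdge_empty, ghteSum_map_liftEdge_empty, ghteSum_map_liftEdge_empty,
    ghteSum_map_liftEdge_empty] at key
  exact key

/-! ### The loop-O(1) partition function is the high-temperature sum on `univ` -/

omit [DecidableRel G.Adj] in
/-- `edgesIn G univ` is the edge set of `G`. -/
theorem edgesIn_univ [G.LocallyFinite] [Fintype G.edgeSet] :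
    edgesIn G (Finset.univ : Finset V) = G.edgeFinset := by
  ext e
  simp [mem_edgesIn_iff]

omit [DecidableRel G.Adj] in
/-- On `univ` the odd-vertex set of `ModifiedSimonInequality` is the full odd-degree set. -/
theorem oddVerts_univ_eq_iff (F : Finset (Sym2 V)) (A : Finset V) :
    oddVerts (Finset.univ : Finset V) F = A ↔ ∀ v, Odd #(F.filter (v ∈ ·)) ↔ v ∈ A := by
  rw [Finset.ext_iff]
  simp only [oddVerts, Finset.mem_filter, Finset.mem_univ, true_and]

/-- **`Z^A_{G,t} = g_{univ}(A)`**: the sourced loop-O(1) partition function is the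
high-temperature sum over the whole vertex set. -/
theorem loopO1PartitionFunction_eq_hteSum (t : ℝ) (A : Finset V) :
    loopO1PartitionFunction G t A = hteSum G Finset.univ t A := by
  unfold loopO1PartitionFunction loopO1Weight hteSum
  rw [← Finset.sum_filter, edgesIn_univ]
  refine Finset.sum_congr ?_ fun _ _ => rfl
  ext F
  simp only [Finset.mem_filter, Finset.mem_powerset, mem_tJoins, Set.subset_univ, true_and,
    oddVerts_univ_eq_iff]
  tauto

/-- The sum of `t^{|F|}` over the `T`-joins with terminal set `A` is `g_{univ}(A)`. -/
theorem sum_tJoins_pow_eq_hteSum (t : ℝ) (A : Finset V) :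
    ∑ F ∈ tJoins G Set.univ A, t ^ #F = hteSum G Finset.univ t A := by
  unfold hteSum
  refine Finset.sum_congr ?_ fun _ _ => rfl
  ext F
  simp only [Finset.mem_filter, Finset.mem_powerset, mem_tJoins, Set.subset_univ, true_and,
    oddVerts_univ_eq_iff, edgesIn_univ]

end Summit.CriticalPhenomena.Ising3DConformalLimit.Theorems.DepletionBound

end
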